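import Summits.AtomisticToContinuum.BoseEinsteinCondensation.Theses.BECHusimiAmplitudeGas
import Summits.AtomisticToContinuum.BoseEinsteinCondensation.Theorems.BECHusimiAmplitudeGasFastFractionBound
import HarnessLib

/-!
# Route BECHusimiAmplitudeGas — the node `PeriodicBECNonneg` (item stmt-AtomisticToContinuum-11996)
# from a Husimi concentration of ANY positive strength

Helper file (`--supports stmt-AtomisticToContinuum-11996`). The tree derives the node from the
three upstream items with the route's tuned constants: `HusimiConcentration` (Husimi ratio
`≥ 1 + N/2`), `TiltStability` (constant `C`), `FastFractionBound` (at `η = 1/(4C)`), giving `c = 1/4`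
(`periodicBECNonneg_of_husimi`, file `BECHusimiAmplitudeGasPeriodicBECNonneg.lean`). The constant
`1/2` of `HusimiConcentration` is itself the output of the Laplace bookkeeping `LaplaceCapUnion`
from the cap masses `⅛ + ⅛` of the two cruxes `PhaseCapDecay`, `AmplitudeLDP`; the route thesis
records that "a refuter-forced retune is a new 1:1 item". This file shows that the node does not
care about the value: a Husimi concentration of ANY fixed positive strength `ε` —
`E_w[|⟨u_c,φ₀⟩|²|F(u_c)|²] ≥ (1 + εN)·E_w[|F(u_c)|²]` with `0 < E_w|F|² < ∞`, same setting and
quantifier pattern as `HusimiConcentration` — together with `TiltStability` (and the proved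
`FastFractionBound`, now at `η = ε/(2C)`) gives `PeriodicBECNonneg` with `c = ε/2`
(`periodicBECNonneg_of_husimi_eps`, `periodicBECNonneg_of_husimi_eps_tilt`). At `ε = 1/2` the
hypothesis is `HusimiConcentration` verbatim (`husimi_eps_half_of_husimiConcentration`), and
`periodicBECNonneg_of_husimi_eps_tilt one_half_pos (husimi_eps_half_of_husimiConcentration h₁) h₂`
re-proves the tree's `periodicBECNonneg_of_husimi_tilt h₁ h₂` (`c = 1/4 = ε/2`).
-/

noncomputable section

open MeasureTheory Filter
open scoped ENNReal NNReal ComplexConjugate BigOperators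

namespace Summit.AtomisticToContinuum.BoseEinsteinCondensation.Theorems

open Literature.MathematicalPhysics.QuantumManyBody.BoseGas Literature.MathematicalPhysics.QuantumManyBody
open Summit.AtomisticToContinuum.BoseEinsteinCondensation.Theses.BECHusimiAmplitudeGas

/-- The `ℝ≥0∞` arithmetic of the ratio-to-condensate step at strength `ε`: from
`ofReal (1 + εN) · D ≤ Num ≤ (n₀ + ofReal C · n_fast + 1) · D`, `0 < D < ∞` and
`n_fast ≤ ofReal (ε/(2C) · N)` conclude `ofReal (ε/2 · N) ≤ n₀`. [folklore] -/
theorem ratioToCondensate_arith_eps {D Num n₀ nfast : ℝ≥0∞} {C ε η : ℝ} {N : ℕ} (hC : 0 < C)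
    (hε : 0 ≤ ε) (hη : η = ε / (2 * C)) (hD0 : D ≠ 0) (hDtop : D ≠ ⊤)
    (hlow : ENNReal.ofReal (1 + ε * N) * D ≤ Num)
    (hup : Num ≤ (n₀ + ENNReal.ofReal C * nfast + 1) * D)
    (hfast : nfast ≤ ENNReal.ofReal (η * N)) :
    ENNReal.ofReal (ε / 2 * N) ≤ n₀ := by
  have h1 : ENNReal.ofReal (1 + ε * N) ≤ n₀ + ENNReal.ofReal C * nfast + 1 :=
    (ENNReal.mul_le_mul_iff_left hD0 hDtop).1 (hlow.trans hup)
  have h2 : ENNReal.ofReal C * nfast ≤ ENNReal.ofReal (ε / 2 * N) := by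
    calc ENNReal.ofReal C * nfast ≤ ENNReal.ofReal C * ENNReal.ofReal (η * N) := by gcongr
      _ = ENNReal.ofReal (C * (η * N)) := (ENNReal.ofReal_mul hC.le).symm
      _ = ENNReal.ofReal (ε / 2 * N) := by
          congr 1
          rw [hη]
          field_simp
  have hq : (0 : ℝ) ≤ ε / 2 * N := by positivity
  have h3 : ENNReal.ofReal (1 + ε * N) =
      ENNReal.ofReal (ε / 2 * N) + (ENNReal.ofReal (ε / 2 * N) + 1) := by
    rw [← ENNReal.ofReal_one, ← ENNReal.ofReal_add hq zero_le_one,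
      ← ENNReal.ofReal_add hq (by positivity)]
    congr 1
    ring
  have h4 : ENNReal.ofReal (ε / 2 * N) + (ENNReal.ofReal (ε / 2 * N) + 1) ≤
      n₀ + (ENNReal.ofReal (ε / 2 * N) + 1) := by
    calc ENNReal.ofReal (ε / 2 * N) + (ENNReal.ofReal (ε / 2 * N) + 1)
        = ENNReal.ofReal (1 + ε * N) := h3.symm
      _ ≤ n₀ + ENNReal.ofReal C * nfast + 1 := h1
      _ ≤ n₀ + ENNReal.ofReal (ε / 2 * N) + 1 := by gcongr
      _ = n₀ + (ENNReal.ofReal (ε / 2 * N) + 1) := by rw [add_assoc]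
  exact ENNReal.le_of_add_le_add_right
    (ENNReal.add_ne_top.2 ⟨ENNReal.ofReal_ne_top, ENNReal.one_ne_top⟩) h4

/-- **Ratio to condensate at strength `ε`.** Suppose that, in the setting and with the quantifier
pattern of `HusimiConcentration`, every nonnegative periodic near-minimiser has a Husimi ratio
`E_w[|⟨u_c,φ₀⟩|²|F(u_c)|²] ≥ (1 + εN)·E_w[|F(u_c)|²]` with `0 < E_w|F(u_c)|² < ∞`, for some FIXED
`ε > 0` (the conditioned all-slow state keeps a fraction `ε` of the particles in the constant mode).
Then `TiltStability` and `FastFractionBound` give the node `PeriodicBECNonneg` with `c = ε/2`: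
with `C` from `TiltStability` take `η = ε/(2C)`, `M = max 1 (M₀ η)`, the least density threshold,
the intersection of the eventual-`N` sets and the least slack; then
`(1 + εN)·D ≤ Num ≤ (n₀ + C·ηN + 1)·D`, `0 < D < ∞`, gives `n₀ ≥ εN − εN/2 = εN/2`. [folklore] -/
theorem periodicBECNonneg_of_husimi_eps {ε : ℝ} (hε : 0 < ε)
    (h₁ : ∀ v : ℝ → ℝ≥0∞, IsRepulsiveFiniteRange v → ∀ M : ℝ, 1 ≤ M → ∃ ρ₀ : ℝ, 0 < ρ₀ ∧
      ∀ ρ : ℝ, 0 < ρ → ρ < ρ₀ → ∀ᶠ N : ℕ in Filter.atTop, ∃ δ : ENNReal, 0 < δ ∧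
      ∀ Ψ : PeriodicTrialState N (sideLength ρ N),
        periodicEnergy v Ψ ≤ periodicGroundStateEnergy v N (sideLength ρ N) + δ →
        (∀ X, Ψ.ψ X = ((‖Ψ.ψ X‖ : ℝ) : ℂ)) →
        let L : ℝ := sideLength ρ N
        let R : ℕ := ⌊M * L * Real.sqrt (ρ * (scatteringLength v).toReal)⌋₊
        let e : (Fin 3 → Fin (2 * R + 1)) → Space → ℂ := fun i x =>
          cellWave L (fun k => ((i k : ℕ) : ℤ) - (R : ℤ)) x / (Real.sqrt (L ^ 3) : ℂ)
        let u : ((Fin 3 → Fin (2 * R + 1)) → ℂ) → Space → ℂ := fun c x => ∑ i, c i * e i x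
        let F : (Space → ℂ) → ℂ := fun g => ∫ X in cellN N L, (∏ j, conj (g (X j))) * Ψ.ψ X
        let ov : (Space → ℂ) → ℂ := fun g => ∫ x in cell L, conj (g x) * constantMode L x
        let w : ((Fin 3 → Fin (2 * R + 1)) → ℂ) → ENNReal := fun c =>
          ENNReal.ofReal (Real.exp (-(∑ i, ‖c i‖ ^ 2)))
        (∫⁻ c : (Fin 3 → Fin (2 * R + 1)) → ℂ, w c * ((‖F (u c)‖₊ : ENNReal) ^ 2)) ≠ 0 ∧
        (∫⁻ c : (Fin 3 → Fin (2 * R + 1)) → ℂ, w c * ((‖F (u c)‖₊ : ENNReal) ^ 2)) ≠ ⊤ ∧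
        ENNReal.ofReal (1 + ε * N) *
            (∫⁻ c : (Fin 3 → Fin (2 * R + 1)) → ℂ, w c * ((‖F (u c)‖₊ : ENNReal) ^ 2)) ≤
          (∫⁻ c : (Fin 3 → Fin (2 * R + 1)) → ℂ,
            w c * ((‖ov (u c)‖₊ : ENNReal) ^ 2) * ((‖F (u c)‖₊ : ENNReal) ^ 2)))
    (h₂ : TiltStability) (h₃ : FastFractionBound) : PeriodicBECNonneg := by
  intro v hv
  obtain ⟨C, hC, hT⟩ := h₂ v hv
  obtain ⟨M₀, hF⟩ := h₃ v hv (ε / (2 * C)) (by positivity)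
  obtain ⟨ρ₁, hρ₁, hH⟩ := h₁ v hv (max 1 M₀) (le_max_left _ _)
  obtain ⟨ρ₂, hρ₂, hT'⟩ := hT (max 1 M₀) (le_max_left _ _)
  obtain ⟨ρ₃, hρ₃, hF'⟩ := hF (max 1 M₀) (le_max_right _ _)
  refine ⟨min ρ₁ (min ρ₂ ρ₃), lt_min hρ₁ (lt_min hρ₂ hρ₃), fun ρ hρ hρlt => ?_⟩
  have hρlt₁ : ρ < ρ₁ := hρlt.trans_le (min_le_left _ _)
  have hρlt₂ : ρ < ρ₂ := hρlt.trans_le ((min_le_right _ _).trans (min_le_left _ _))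
  have hρlt₃ : ρ < ρ₃ := hρlt.trans_le ((min_le_right _ _).trans (min_le_right _ _))
  refine ⟨ε / 2, half_pos hε, ?_⟩
  filter_upwards [hH ρ hρ hρlt₁, hT' ρ hρ hρlt₂, hF' ρ hρ hρlt₃] with N hN₁ hN₂ hN₃
  obtain ⟨δ₁, hδ₁, hN₁⟩ := hN₁
  obtain ⟨δ₂, hδ₂, hN₂⟩ := hN₂
  obtain ⟨δ₃, hδ₃, hN₃⟩ := hN₃
  refine ⟨min δ₁ (min δ₂ δ₃), lt_min hδ₁ (lt_min hδ₂ hδ₃), fun Ψ hE hpos => ?_⟩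
  have hE₁ := hN₁ Ψ (hE.trans (add_le_add le_rfl (min_le_left _ _))) hpos
  have hE₂ := hN₂ Ψ (hE.trans (add_le_add le_rfl ((min_le_right _ _).trans (min_le_left _ _))))
    hpos
  have hE₃ := hN₃ Ψ (hE.trans (add_le_add le_rfl ((min_le_right _ _).trans (min_le_right _ _))))
  obtain ⟨hD0, hDtop, hlow⟩ := hE₁
  exact ratioToCondensate_arith_eps hC hε.le rfl hD0 hDtop hlow hE₂ hE₃

/-- **The node from an `ε`-strength Husimi concentration and `TiltStability`**, the fast-fraction
input being the proved item `FastFractionBound` (`fastFractionBound_proof`); `c = ε/2`. [folklore] -/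
theorem periodicBECNonneg_of_husimi_eps_tilt {ε : ℝ} (hε : 0 < ε)
    (h₁ : ∀ v : ℝ → ℝ≥0∞, IsRepulsiveFiniteRange v → ∀ M : ℝ, 1 ≤ M → ∃ ρ₀ : ℝ, 0 < ρ₀ ∧
      ∀ ρ : ℝ, 0 < ρ → ρ < ρ₀ → ∀ᶠ N : ℕ in Filter.atTop, ∃ δ : ENNReal, 0 < δ ∧
      ∀ Ψ : PeriodicTrialState N (sideLength ρ N),
        periodicEnergy v Ψ ≤ periodicGroundStateEnergy v N (sideLength ρ N) + δ →
        (∀ X, Ψ.ψ X = ((‖Ψ.ψ X‖ : ℝ) : ℂ)) →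
        let L : ℝ := sideLength ρ N
        let R : ℕ := ⌊M * L * Real.sqrt (ρ * (scatteringLength v).toReal)⌋₊
        let e : (Fin 3 → Fin (2 * R + 1)) → Space → ℂ := fun i x =>
          cellWave L (fun k => ((i k : ℕ) : ℤ) - (R : ℤ)) x / (Real.sqrt (L ^ 3) : ℂ)
        let u : ((Fin 3 → Fin (2 * R + 1)) → ℂ) → Space → ℂ := fun c x => ∑ i, c i * e i x
        let F : (Space → ℂ) → ℂ := fun g => ∫ X in cellN N L, (∏ j, conj (g (X j))) * Ψ.ψ X
        let ov : (Space → ℂ) → ℂ := fun g => ∫ x in cell L, conj (g x) * constantMode L x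
        let w : ((Fin 3 → Fin (2 * R + 1)) → ℂ) → ENNReal := fun c =>
          ENNReal.ofReal (Real.exp (-(∑ i, ‖c i‖ ^ 2)))
        (∫⁻ c : (Fin 3 → Fin (2 * R + 1)) → ℂ, w c * ((‖F (u c)‖₊ : ENNReal) ^ 2)) ≠ 0 ∧
        (∫⁻ c : (Fin 3 → Fin (2 * R + 1)) → ℂ, w c * ((‖F (u c)‖₊ : ENNReal) ^ 2)) ≠ ⊤ ∧
        ENNReal.ofReal (1 + ε * N) *
            (∫⁻ c : (Fin 3 → Fin (2 * R + 1)) → ℂ, w c * ((‖F (u c)‖₊ : ENNReal) ^ 2)) ≤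
          (∫⁻ c : (Fin 3 → Fin (2 * R + 1)) → ℂ,
            w c * ((‖ov (u c)‖₊ : ENNReal) ^ 2) * ((‖F (u c)‖₊ : ENNReal) ^ 2)))
    (h₂ : TiltStability) : PeriodicBECNonneg :=
  periodicBECNonneg_of_husimi_eps hε h₁ h₂ fastFractionBound_proof

/-- `HusimiConcentration` is the `ε = 1/2` instance of the `ε`-strength hypothesis
(`1 + N/2 = 1 + (1/2)·N`). [folklore] -/
theorem husimi_eps_half_of_husimiConcentration (h : HusimiConcentration) :
    ∀ v : ℝ → ℝ≥0∞, IsRepulsiveFiniteRange v → ∀ M : ℝ, 1 ≤ M → ∃ ρ₀ : ℝ, 0 < ρ₀ ∧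
      ∀ ρ : ℝ, 0 < ρ → ρ < ρ₀ → ∀ᶠ N : ℕ in Filter.atTop, ∃ δ : ENNReal, 0 < δ ∧
      ∀ Ψ : PeriodicTrialState N (sideLength ρ N),
        periodicEnergy v Ψ ≤ periodicGroundStateEnergy v N (sideLength ρ N) + δ →
        (∀ X, Ψ.ψ X = ((‖Ψ.ψ X‖ : ℝ) : ℂ)) →
        let L : ℝ := sideLength ρ N
        let R : ℕ := ⌊M * L * Real.sqrt (ρ * (scatteringLength v).toReal)⌋₊
        let e : (Fin 3 → Fin (2 * R + 1)) → Space → ℂ := fun i x =>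
          cellWave L (fun k => ((i k : ℕ) : ℤ) - (R : ℤ)) x / (Real.sqrt (L ^ 3) : ℂ)
        let u : ((Fin 3 → Fin (2 * R + 1)) → ℂ) → Space → ℂ := fun c x => ∑ i, c i * e i x
        let F : (Space → ℂ) → ℂ := fun g => ∫ X in cellN N L, (∏ j, conj (g (X j))) * Ψ.ψ X
        let ov : (Space → ℂ) → ℂ := fun g => ∫ x in cell L, conj (g x) * constantMode L x
        let w : ((Fin 3 → Fin (2 * R + 1)) → ℂ) → ENNReal := fun c =>
          ENNReal.ofReal (Real.exp (-(∑ i, ‖c i‖ ^ 2)))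
        (∫⁻ c : (Fin 3 → Fin (2 * R + 1)) → ℂ, w c * ((‖F (u c)‖₊ : ENNReal) ^ 2)) ≠ 0 ∧
        (∫⁻ c : (Fin 3 → Fin (2 * R + 1)) → ℂ, w c * ((‖F (u c)‖₊ : ENNReal) ^ 2)) ≠ ⊤ ∧
        ENNReal.ofReal (1 + (1 / 2) * N) *
            (∫⁻ c : (Fin 3 → Fin (2 * R + 1)) → ℂ, w c * ((‖F (u c)‖₊ : ENNReal) ^ 2)) ≤
          (∫⁻ c : (Fin 3 → Fin (2 * R + 1)) → ℂ,
            w c * ((‖ov (u c)‖₊ : ENNReal) ^ 2) * ((‖F (u c)‖₊ : ENNReal) ^ 2)) := by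
  intro v hv M hM
  obtain ⟨ρ₀, hρ₀, H⟩ := h v hv M hM
  refine ⟨ρ₀, hρ₀, fun ρ hρ hρlt => ?_⟩
  filter_upwards [H ρ hρ hρlt] with N ⟨δ, hδ, hΨ⟩
  refine ⟨δ, hδ, fun Ψ hE hpos => ?_⟩
  have h1 := hΨ Ψ hE hpos
  have hN : (1 : ℝ) + 1 / 2 * N = 1 + (N : ℝ) / 2 := by ring
  rw [hN]
  exact h1

end Summit.AtomisticToContinuum.BoseEinsteinCondensation.Theorems

end
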